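import Summits.FinalStateConjecture.FinalStateConjecture.Theorems.SwallowTheDatumUniversalWitnessFamilyStubCapEndAux2
import Summits.FinalStateConjecture.FinalStateConjecture.Theorems.SwallowTheDatumUniversalWitnessFamilyStubSiteReadingDev
import Mathlib.Analysis.Calculus.ContDiff.Bounds
import HarnessLib

/-!
# Stub `stub_kelvinRemainder` of the line `Sketch` (crux `SwallowTheDatum.UniversalWitnessFamily`,
# item stmt-FinalStateConjecture-10051) — toolkit T2 of `stub_bulkAt`: Kelvin transport of a remainder

At the END site the Brill–Lindquist bulk `B` (time-symmetric, conformally flat with factor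
`ψ = A + (M/2)/‖y‖ + R`, `R` a small multipole remainder on the shell `{ρ₃/512 < ‖y‖ < ρ₃/4}`,
`‖D^m R(y)‖ ≤ ε (M/2) ρ₃² / ‖y‖^{m+3}`) is read through the sheet-2 inversion `y = inv ρ₃ z`
(`invReadH/invReadK` of the engine `…ParametricKerrBurialEngine`).  This file proves that on the
unit-chart annulus `16 ≤ ‖x‖ ≤ 128` the reading is `C²`-close, linearly in `ε` with ONE absolute
constant, to the exact Schwarzschild far field `schwField (A M/X₃)` (and its `k`-part vanishes):

* §1 rescaling to depth `1`: `inv ρ₃ = ρ₃ • inv 1`, and the rescaled remainder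
  `q(u) = (2ρ₃/M) R(ρ₃ u)` has `‖D^i q(u)‖ ≤ ε/‖u‖^{i+3} ≤ 128⁵ ε` on `1/128 ≤ ‖u‖ ≤ 1/16`
  (the scaling `‖D^m (F ∘ (ρ₃ ·))‖ ≤ ρ₃^m ‖D^m F‖` of `…StubEndRescaling`; the `ρ₃`'s cancel);
  absolute bounds for `D^i (inv 1)` (`i ≤ 3`) on the annulus and for `D^i (‖·‖⁻¹)` (`i ≤ 2`) on
  `{1/128 ≤ ‖u‖ ≤ 1/16}` (continuity on compacta, `exists_bound_iteratedFDeriv_of_isCompact`);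
* §2 KELVIN: with `X₃ ρ₃ = (M/2)²`, `invReadH B − schwField (AM/X₃)` is, near the annulus, the
  coordinate pull-back `bilinPullback (inv 1)` of the field `((p + q)⁴ − p⁴) • δ`,
  `p(u) = AM/(2X₃) + 1/‖u‖`, `(p + q)⁴ − p⁴ = q (2p + q)((p + q)² + p²)` (pointwise `C²` calculus of
  `…StubSiteReadingDev`: `srd_c2_add/mul`), whence the claim by the LINEAR `C²` estimate
  `norm_iteratedFDeriv_bilinPullback_le` of `Literature/…/BilinPullbackEstimates`.

References: C. W. Misner, K. S. Thorne, J. A. Wheeler, *Gravitation* (1973), §31.7 (the inversion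
isometry of the Schwarzschild throat); Brill–Lindquist, Phys. Rev. 131 (1963) 471; Mao–Oh–Tao
arXiv:2308.13031 Thm 1.7, Rem 1.11.
-/

-- the doubled `FinalStateConjecture` path component is the summit/problem naming scheme, not a mistake
set_option linter.dupNamespace false
-- instance search through the nested operator type `E3 →L[ℝ] E3 →L[ℝ] ℝ`
set_option maxSynthPendingDepth 2

noncomputable section

namespace Summit.FinalStateConjecture.FinalStateConjecture.Theorems.SwallowTheDatum.UniversalWitnessFamily

open scoped Manifold ContDiff Topology InnerProductSpace RealInnerProductSpace
open Set Filter Function Literature.Geometry.Lorentzian Literature.Geometry.Lorentzian.InitialDataSet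
open Summit.FinalStateConjecture.FinalStateConjecture.Theorems.SwallowTheDatum.ParametricKerrBurial
  (schwField inv invReadH invReadK norm_iteratedFDeriv_comp_smul_le)

/-! ## §1 Rescaling to depth `1` and the absolute constants -/

/-- `C²` size of `f • L` for a constant vector `L`: `‖D^i (f • L)‖ ≤ ‖L‖ ‖D^i f‖`
(`iteratedFDeriv_smul_const_apply`). [folklore] -/
theorem kr_bd_smul_const {V : Type*} [NormedAddCommGroup V] [NormedSpace ℝ V]
    {T : Set E3} (hT : IsOpen T) {u₀ : E3} (hu : u₀ ∈ T) {f : E3 → ℝ}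
    (hf : ContDiffOn ℝ ∞ f T) {F : ℝ} (hF : ∀ i ≤ 2, ‖iteratedFDeriv ℝ i f u₀‖ ≤ F) (L : V) :
    ContDiffOn ℝ ∞ (fun u ↦ f u • L) T ∧
      ∀ i ≤ 2, ‖iteratedFDeriv ℝ i (fun u ↦ f u • L) u₀‖ ≤ ‖L‖ * F := by
  refine ⟨hf.smul contDiffOn_const, fun i hi ↦ ?_⟩
  have hfa : ContDiffAt ℝ i f u₀ := (hf.contDiffAt (hT.mem_nhds hu)).of_le (by exact_mod_cast le_top)
  rw [iteratedFDeriv_smul_const_apply hfa]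
  refine (ContinuousLinearMap.norm_compContinuousMultilinearMap_le _ _).trans ?_
  rw [ContinuousLinearMap.norm_smulRight_apply, ContinuousLinearMap.norm_id, one_mul]
  exact mul_le_mul_of_nonneg_left (hF i hi) (norm_nonneg _)

/-- The closed annulus `{a ≤ ‖y‖ ≤ b}` of `ℝ³` is compact. [folklore] -/
theorem kr_isCompact_annulus (a b : ℝ) : IsCompact ({y : E3 | a ≤ ‖y‖} ∩ {y : E3 | ‖y‖ ≤ b}) :=
  (isCompact_closedBall (0 : E3) b).of_isClosed_subset
    ((isClosed_le continuous_const continuous_norm).inter (isClosed_le continuous_norm continuous_const))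
    fun _ hy ↦ mem_closedBall_zero_iff.2 hy.2

/-- One absolute bound `Θ ≥ 1` for `‖D^i (inv 1)(x)‖`, `1 ≤ i ≤ 3`, on the annulus `16 ≤ ‖x‖ ≤ 128`
(`inv 1` is smooth off the origin; continuity on the compact annulus). [folklore] -/
theorem kr_exists_Theta : ∃ Θ : ℝ, 1 ≤ Θ ∧ ∀ i, 1 ≤ i → i ≤ 3 → ∀ x : E3, 16 ≤ ‖x‖ → ‖x‖ ≤ 128 →
    ‖iteratedFDeriv ℝ i (inv 1) x‖ ≤ Θ := by
  have hθ : ContDiffOn ℝ (2 + 1) (inv 1) {x : E3 | x ≠ 0} := fun x hx ↦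
    (contDiffAt_sInv 1 hx).contDiffWithinAt
  have hK : ({y : E3 | 16 ≤ ‖y‖} ∩ {y : E3 | ‖y‖ ≤ 128}) ⊆ {x : E3 | x ≠ 0} := fun y hy ↦
    norm_pos_iff.1 (lt_of_lt_of_le (by norm_num) hy.1)
  obtain ⟨Θ, hΘ1, hΘ⟩ := exists_bound_iteratedFDeriv_of_isCompact isOpen_ne (k := 2) hθ
    (kr_isCompact_annulus 16 128) hK
  exact ⟨Θ, hΘ1, fun i h1 hi x hx1 hx2 ↦ hΘ i h1 hi x ⟨hx1, hx2⟩⟩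

/-- One absolute bound for `‖D^i (‖·‖⁻¹)(u)‖`, `i ≤ 2`, on the inverted annulus `1/128 ≤ ‖u‖ ≤ 1/16`
(orders `1, 2` by continuity on the compact annulus, order `0` is `1/‖u‖ ≤ 128`). [folklore] -/
theorem kr_exists_nuBound : ∃ Bν : ℝ, 1 ≤ Bν ∧ ∀ i ≤ 2, ∀ u : E3, 1 / 128 ≤ ‖u‖ → ‖u‖ ≤ 1 / 16 →
    ‖iteratedFDeriv ℝ i (fun u : E3 ↦ ‖u‖⁻¹) u‖ ≤ Bν := by
  have hθ : ContDiffOn ℝ (1 + 1) (fun u : E3 ↦ ‖u‖⁻¹) {x : E3 | x ≠ 0} := fun x hx ↦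
    ((contDiffAt_norm ℝ hx).inv (norm_ne_zero_iff.2 hx)).contDiffWithinAt
  have hK : ({y : E3 | 1 / 128 ≤ ‖y‖} ∩ {y : E3 | ‖y‖ ≤ 1 / 16}) ⊆ {x : E3 | x ≠ 0} := fun y hy ↦
    norm_pos_iff.1 (lt_of_lt_of_le (by norm_num) hy.1)
  obtain ⟨Θ, hΘ1, hΘ⟩ := exists_bound_iteratedFDeriv_of_isCompact isOpen_ne (k := 1) hθ
    (kr_isCompact_annulus (1 / 128) (1 / 16)) hK
  refine ⟨Θ + 128, by linarith, fun i hi u hu1 hu2 ↦ ?_⟩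
  rcases Nat.eq_zero_or_pos i with rfl | hpos
  · rw [norm_iteratedFDeriv_zero, norm_inv, norm_norm]
    have : ‖u‖⁻¹ ≤ 128 := inv_le_of_inv_le₀ (by norm_num) (by rw [inv_eq_one_div]; exact hu1)
    linarith
  · have := hΘ i hpos (by omega) u ⟨hu1, hu2⟩
    linarith

/-- `inv ρ₃ = ρ₃ • inv 1`: the inversion at depth `ρ₃` is the depth-`1` inversion rescaled. [folklore] -/
theorem kr_smul_sInv_one (ρ₃ : ℝ) (z : E3) : ρ₃ • inv 1 z = inv ρ₃ z := by
  rw [inv, inv, smul_smul]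
  congr 1
  ring

/-- **The rescaled remainder** `q(u) = (2ρ₃/M) R(ρ₃ u)`: smooth on `{1/512 < ‖u‖ < 1/4}` and
`‖D^i q(u)‖ ≤ ε/‖u‖^{i+3} ≤ 128⁵ ε` for `i ≤ 2`, `1/128 ≤ ‖u‖ ≤ 1/16` — the scaling
`‖D^i (R ∘ (ρ₃ ·))(u)‖ ≤ ρ₃^i ‖D^i R(ρ₃ u)‖` (`norm_iteratedFDeriv_comp_smul_le`) against the decay
`‖D^i R(y)‖ ≤ ε (M/2) ρ₃²/‖y‖^{i+3}`: all powers of `ρ₃` and `M` cancel. [folklore] -/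
theorem kr_R2_bound {R : E3 → ℝ} {ρ₃ M ε : ℝ} (hρ : 0 < ρ₃) (hM : 0 < M) (hε : 0 ≤ ε)
    (hRs : ContDiffOn ℝ ∞ R {y : E3 | ρ₃ / 512 < ‖y‖ ∧ ‖y‖ < ρ₃ / 4})
    (hRb : ∀ m : ℕ, m ≤ 2 → ∀ y : E3, ρ₃ / 512 < ‖y‖ → ‖y‖ < ρ₃ / 4 →
        ‖iteratedFDeriv ℝ m R y‖ ≤ ε * (M / 2) * ρ₃ ^ 2 / ‖y‖ ^ (m + 3)) :
    ContDiffOn ℝ ∞ (fun u : E3 ↦ (2 * ρ₃ / M) • R (ρ₃ • u)) {u : E3 | 1 / 512 < ‖u‖ ∧ ‖u‖ < 1 / 4} ∧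
    ∀ u : E3, 1 / 128 ≤ ‖u‖ → ‖u‖ ≤ 1 / 16 → ∀ i ≤ 2,
      ‖iteratedFDeriv ℝ i (fun u : E3 ↦ (2 * ρ₃ / M) • R (ρ₃ • u)) u‖ ≤ 128 ^ 5 * ε := by
  have hns : ∀ u : E3, ‖ρ₃ • u‖ = ρ₃ * ‖u‖ := fun u ↦ by
    rw [norm_smul, Real.norm_of_nonneg hρ.le]
  have hmaps : MapsTo (fun u : E3 ↦ ρ₃ • u) {u : E3 | 1 / 512 < ‖u‖ ∧ ‖u‖ < 1 / 4}
      {y : E3 | ρ₃ / 512 < ‖y‖ ∧ ‖y‖ < ρ₃ / 4} := fun u hu ↦ by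
    refine ⟨?_, ?_⟩
    · rw [hns]; have := hu.1; nlinarith
    · rw [hns]; have := hu.2; nlinarith
  have hcomp : ContDiffOn ℝ ∞ (fun u : E3 ↦ R (ρ₃ • u)) {u : E3 | 1 / 512 < ‖u‖ ∧ ‖u‖ < 1 / 4} :=
    hRs.comp (contDiff_const_smul ρ₃).contDiffOn hmaps
  have hT : IsOpen {u : E3 | 1 / 512 < ‖u‖ ∧ ‖u‖ < 1 / 4} :=
    (isOpen_lt continuous_const continuous_norm).inter (isOpen_lt continuous_norm continuous_const)
  refine ⟨hcomp.const_smul (2 * ρ₃ / M), fun u hu1 hu2 i hi ↦ ?_⟩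
  have huT : u ∈ {u : E3 | 1 / 512 < ‖u‖ ∧ ‖u‖ < 1 / 4} :=
    ⟨lt_of_lt_of_le (by norm_num) hu1, lt_of_le_of_lt hu2 (by norm_num)⟩
  have hu0 : 0 < ‖u‖ := lt_of_lt_of_le (by norm_num) hu1
  have hca : ContDiffAt ℝ i (fun u : E3 ↦ R (ρ₃ • u)) u :=
    (hcomp.contDiffAt (hT.mem_nhds huT)).of_le (by exact_mod_cast le_top)
  rw [iteratedFDeriv_const_smul_apply' hca, norm_smul, Real.norm_of_nonneg (by positivity)]
  have h1 := norm_iteratedFDeriv_comp_smul_le R hρ i u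
  have hy := hmaps huT
  have h2 := hRb i hi (ρ₃ • u) hy.1 hy.2
  rw [hns] at h2
  have hui : ‖u‖⁻¹ ≤ 128 := inv_le_of_inv_le₀ (by norm_num) (by rw [inv_eq_one_div]; exact hu1)
  calc 2 * ρ₃ / M * ‖iteratedFDeriv ℝ i (fun y ↦ R (ρ₃ • y)) u‖
      ≤ 2 * ρ₃ / M * (ρ₃ ^ i * (ε * (M / 2) * ρ₃ ^ 2 / (ρ₃ * ‖u‖) ^ (i + 3))) := by
        refine mul_le_mul_of_nonneg_left (h1.trans ?_) (by positivity)
        exact mul_le_mul_of_nonneg_left h2 (by positivity)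
    _ = ε / ‖u‖ ^ (i + 3) := by
        field_simp
        ring
    _ = ε * (‖u‖⁻¹) ^ (i + 3) := by
        rw [div_eq_mul_inv, inv_pow]
    _ ≤ ε * 128 ^ 5 := by
        refine mul_le_mul_of_nonneg_left ?_ hε
        calc (‖u‖⁻¹) ^ (i + 3) ≤ 128 ^ (i + 3) := pow_le_pow_left₀ (by positivity) hui _
          _ ≤ 128 ^ 5 := pow_le_pow_right₀ (by norm_num) (by omega)
    _ = 128 ^ 5 * ε := mul_comm _ _

/-! ## §2 Kelvin: the reading minus the Schwarzschild far field, and the assembly -/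

/-- The scalar identity behind Kelvin's transport of the bulk: with `X₃ ρ₃ = (M/2)²`,
`X₃⁻² (A + (M/2)/(ρ₃/r) + t)⁴ (ρ₃/r²)² − (1 + AM/(2X₃ r))⁴ = q (2p + q)((p + q)² + p²) · (1/r²)²`,
`p = AM/(2X₃) + r`, `q = (2ρ₃/M) t`. [folklore] -/
theorem kr_scalar {A M ρ₃ X₃ r t s : ℝ} (hM : M ≠ 0) (hX : X₃ ≠ 0) (hr : r ≠ 0)
    (hrel : X₃ * ρ₃ = (M / 2) ^ 2) :
    (X₃ ^ 2)⁻¹ * ((A + M / 2 / (ρ₃ / r) + t) ^ 4 * ((ρ₃ / r ^ 2) ^ 2 * s)) -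
        (1 + A * M / X₃ / (2 * r)) ^ 4 * s =
      2 * ρ₃ / M * t * ((A * M / X₃ / 2 + (1 / r)⁻¹ + 2 * ρ₃ / M * t + (A * M / X₃ / 2 + (1 / r)⁻¹)) *
        ((A * M / X₃ / 2 + (1 / r)⁻¹ + 2 * ρ₃ / M * t) * (A * M / X₃ / 2 + (1 / r)⁻¹ + 2 * ρ₃ / M * t) +
          (A * M / X₃ / 2 + (1 / r)⁻¹) * (A * M / X₃ / 2 + (1 / r)⁻¹))) * ((1 / r ^ 2) ^ 2 * s) := by
  have hρ : ρ₃ = (M / 2) ^ 2 / X₃ := by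
    rw [eq_div_iff hX, mul_comm]; exact hrel
  subst hρ
  field_simp
  ring

/-- **The difference of fourth powers, peeled**: for `p, q` smooth on an open `T ∋ u₀` with `C²` sizes
`≤ P` and `≤ Q ε` (`ε ≤ 1`) at `u₀`, the field `(q (2p + q)((p + q)² + p²)) • δ` is smooth on `T`
with `C²` size `≤ C ε` at `u₀`, `C = C(P, Q)` (Leibniz at a point, `srd_c2_add/mul`; `‖δ‖ ≤ 1`).
[folklore] -/
theorem kr_poly_const {P Q : ℝ} (hP0 : 0 ≤ P) (hQ0 : 0 ≤ Q) : ∃ C : ℝ, 0 < C ∧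
    ∀ ⦃T : Set E3⦄, IsOpen T → ∀ ⦃u₀ : E3⦄, u₀ ∈ T → ∀ ⦃p q : E3 → ℝ⦄,
      ContDiffOn ℝ ∞ p T → ContDiffOn ℝ ∞ q T → ∀ ⦃ε : ℝ⦄, 0 ≤ ε → ε ≤ 1 →
      (∀ i ≤ 2, ‖iteratedFDeriv ℝ i p u₀‖ ≤ P) → (∀ i ≤ 2, ‖iteratedFDeriv ℝ i q u₀‖ ≤ Q * ε) →
      ContDiffOn ℝ ∞ (fun u ↦ (q u * ((p u + q u + p u) * ((p u + q u) * (p u + q u) + p u * p u))) •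
          (innerSL ℝ : E3 →L[ℝ] E3 →L[ℝ] ℝ)) T ∧
        ∀ i ≤ 2, ‖iteratedFDeriv ℝ i (fun u ↦ (q u * ((p u + q u + p u) *
          ((p u + q u) * (p u + q u) + p u * p u))) • (innerSL ℝ : E3 →L[ℝ] E3 →L[ℝ] ℝ)) u₀‖ ≤ C * ε := by
  refine ⟨4 * Q * (4 * (P + Q + P) * (4 * (P + Q) * (P + Q) + 4 * P * P)) + 1, by positivity, ?_⟩
  intro T hT u₀ hu p q hp hq ε hε0 hε1 hPb hQb
  have hQw : ∀ i ≤ 2, ‖iteratedFDeriv ℝ i q u₀‖ ≤ Q := fun i hi ↦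
    (hQb i hi).trans (mul_le_of_le_one_right hQ0 hε1)
  have hpq := hp.add hq
  have e1 := srd_c2_add hT hu hp hq hPb hQw
  have e2 := srd_c2_add hT hu hpq hp e1 hPb
  have e5 := srd_c2_add hT hu (hpq.mul hpq) (hp.mul hp) (srd_c2_mul hT hu hpq hpq e1 e1)
    (srd_c2_mul hT hu hp hp hPb hPb)
  have e6 := srd_c2_mul hT hu (hpq.add hp) ((hpq.mul hpq).add (hp.mul hp)) e2 e5
  have e7 := srd_c2_mul hT hu hq ((hpq.add hp).mul ((hpq.mul hpq).add (hp.mul hp))) hQb e6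
  have hfin := kr_bd_smul_const hT hu (hq.mul ((hpq.add hp).mul ((hpq.mul hpq).add (hp.mul hp)))) e7
    (innerSL ℝ : E3 →L[ℝ] E3 →L[ℝ] ℝ)
  refine ⟨hfin.1, fun i hi ↦ (hfin.2 i hi).trans ?_⟩
  have h1 : ‖(innerSL ℝ : E3 →L[ℝ] E3 →L[ℝ] ℝ)‖ ≤ 1 := norm_innerSL_le ℝ
  calc ‖(innerSL ℝ : E3 →L[ℝ] E3 →L[ℝ] ℝ)‖ *
        (4 * (Q * ε) * (4 * (P + Q + P) * (4 * (P + Q) * (P + Q) + 4 * P * P)))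
      ≤ 1 * (4 * (Q * ε) * (4 * (P + Q + P) * (4 * (P + Q) * (P + Q) + 4 * P * P))) :=
        mul_le_mul_of_nonneg_right h1 (by positivity)
    _ = (4 * Q * (4 * (P + Q + P) * (4 * (P + Q) * (P + Q) + 4 * P * P))) * ε := by ring
    _ ≤ (4 * Q * (4 * (P + Q + P) * (4 * (P + Q) * (P + Q) + 4 * P * P)) + 1) * ε :=
        mul_le_mul_of_nonneg_right (le_add_of_nonneg_right zero_le_one) hε0

/-- **Toolkit T2 (Kelvin transport of a remainder)** of `stub_bulkAt`: for the time-symmetric bulk `B`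
with metric `(A + (M/2)/‖y‖ + R y)⁴ • δ` on the shell `{ρ₃/512 < ‖y‖ < ρ₃/4}`, the remainder obeying
`‖D^m R(y)‖ ≤ ε (M/2) ρ₃²/‖y‖^{m+3}` (`m ≤ 2`), and `X₃ ρ₃ = (M/2)²`, the inverted reading at depth `ρ₃`
and scale `X₃` has `k`-part `0` and metric part `C²`-close, on the unit-chart annulus `16 ≤ ‖x‖ ≤ 128`,
to the exact Schwarzschild far field `schwField (AM/X₃)`:
`‖D^m (invReadH B − schwField (AM/X₃))(x)‖ ≤ K ε`, one absolute `K` (MTW 1973, §31.7: the inversion in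
the throat sphere is an isometry of isotropic Schwarzschild). [folklore] -/
theorem stub_kelvinRemainder :
    ∃ K : ℝ, 0 < K ∧ ∀ (A M ρ₃ X₃ ε : ℝ) (R : E3 → ℝ) (B : InitialDataSet (𝓡 3) E3),
      1 ≤ A → A ≤ 8 → 0 < M → M ≤ X₃ → 0 < ρ₃ → X₃ * ρ₃ = (M / 2) ^ 2 → 0 ≤ ε → ε ≤ 1 →
      (∀ y : E3, B.k y = 0) →
      ContDiffOn ℝ ∞ R {y : E3 | ρ₃ / 512 < ‖y‖ ∧ ‖y‖ < ρ₃ / 4} →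
      (∀ m : ℕ, m ≤ 2 → ∀ y : E3, ρ₃ / 512 < ‖y‖ → ‖y‖ < ρ₃ / 4 →
        ‖iteratedFDeriv ℝ m R y‖ ≤ ε * (M / 2) * ρ₃ ^ 2 / ‖y‖ ^ (m + 3)) →
      (∀ y : E3, ρ₃ / 512 < ‖y‖ → ‖y‖ < ρ₃ / 4 →
        B.coordH y = (A + M / 2 / ‖y‖ + R y) ^ 4 • (innerSL ℝ : E3 →L[ℝ] E3 →L[ℝ] ℝ)) →
      ∀ x : E3, 16 ≤ ‖x‖ → ‖x‖ ≤ 128 →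
        invReadK B ρ₃ X₃ x = 0 ∧
        ∀ m : ℕ, m ≤ 2 → ‖iteratedFDeriv ℝ m
          (fun z : E3 ↦ invReadH B ρ₃ X₃ z - schwField (A * M / X₃) z) x‖ ≤ K * ε := by
  obtain ⟨Θ, hΘ1, hΘ⟩ := kr_exists_Theta
  obtain ⟨Bν, hBν1, hBν⟩ := kr_exists_nuBound
  obtain ⟨C, hC0, hC⟩ := kr_poly_const (P := 4 + Bν) (Q := 128 ^ 5) (by linarith) (by positivity)
  refine ⟨32 * Θ ^ 4 * C, by positivity, ?_⟩
  intro A M ρ₃ X₃ ε R B hA1 hA8 hM hMX hρ hrel hε0 hε1 hk hRs hRb hH x hx16 hx128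
  have hX : 0 < X₃ := hM.trans_le hMX
  have hx0' : 0 < ‖x‖ := lt_of_lt_of_le (by norm_num) hx16
  refine ⟨?_, fun m hm ↦ ?_⟩
  · ext v w
    rw [invReadK_apply, coordK_apply, hk]
    simp
  -- the open neighbourhoods of the two annuli: `U` on the `z`-side, `T = inv 1 (U)` on the `u`-side
  set U : Set E3 := {z : E3 | 4 < ‖z‖ ∧ ‖z‖ < 512} with hUdef
  have hU : IsOpen U :=
    (isOpen_lt continuous_const continuous_norm).inter (isOpen_lt continuous_norm continuous_const)
  have hxU : x ∈ U := ⟨by linarith, by linarith⟩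
  set T : Set E3 := {u : E3 | 1 / 512 < ‖u‖ ∧ ‖u‖ < 1 / 4} with hTdef
  have hT : IsOpen T :=
    (isOpen_lt continuous_const continuous_norm).inter (isOpen_lt continuous_norm continuous_const)
  have hn1 : ∀ z : E3, ‖inv 1 z‖ = 1 / ‖z‖ := fun z ↦ norm_sInv (zero_le_one : (0 : ℝ) ≤ 1) z
  have hmaps : MapsTo (inv 1) U T := fun z hz ↦ by
    have hz0 : 0 < ‖z‖ := lt_trans (by norm_num) hz.1
    refine ⟨?_, ?_⟩
    · show 1 / 512 < ‖inv 1 z‖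
      rw [hn1]
      exact one_div_lt_one_div_of_lt hz0 hz.2
    · show ‖inv 1 z‖ < 1 / 4
      rw [hn1]
      exact one_div_lt_one_div_of_lt (by norm_num) hz.1
  have hu1 : 1 / 128 ≤ ‖inv 1 x‖ := by
    rw [hn1]
    exact one_div_le_one_div_of_le hx0' hx128
  have hu2 : ‖inv 1 x‖ ≤ 1 / 16 := by
    rw [hn1]
    exact one_div_le_one_div_of_le (by norm_num) hx16
  have huT : inv 1 x ∈ T := hmaps hxU
  -- the two scalar players on the `u`-side: `p = AM/(2X₃) + 1/‖u‖`, `q = (2ρ₃/M) R(ρ₃ u)`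
  obtain ⟨p, hp_def⟩ : ∃ p : E3 → ℝ, p = fun u ↦ A * M / X₃ / 2 + ‖u‖⁻¹ := ⟨_, rfl⟩
  obtain ⟨q, hq_def⟩ : ∃ q : E3 → ℝ, q = fun u ↦ (2 * ρ₃ / M) • R (ρ₃ • u) := ⟨_, rfl⟩
  have ha0 : 0 ≤ A * M / X₃ / 2 := by
    have : 0 ≤ A := le_trans zero_le_one hA1
    positivity
  have ha8 : A * M / X₃ / 2 ≤ 4 := by
    have hMX' : M / X₃ ≤ 1 := (div_le_one hX).2 hMX
    have h8 : A * M / X₃ ≤ 8 := by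
      rw [mul_div_assoc]
      have : 0 ≤ M / X₃ := by positivity
      nlinarith
    linarith
  have hνT : ContDiffOn ℝ ∞ (fun u : E3 ↦ ‖u‖⁻¹) T := fun u hu ↦ by
    have hu0 : u ≠ 0 := norm_pos_iff.1 (lt_trans (by norm_num) hu.1)
    exact ((contDiffAt_norm ℝ hu0).inv (norm_ne_zero_iff.2 hu0)).contDiffWithinAt
  have hp : ContDiffOn ℝ ∞ p T ∧ ∀ i ≤ 2, ‖iteratedFDeriv ℝ i p (inv 1 x)‖ ≤ 4 + Bν := by
    rw [hp_def]
    refine ⟨contDiffOn_const.add hνT, srd_c2_add hT huT contDiffOn_const hνT ?_ ?_⟩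
    · exact fun i hi ↦ (srd_c2_const _ _ i hi).trans (by rw [abs_of_nonneg ha0]; exact ha8)
    · exact fun i hi ↦ hBν i hi _ hu1 hu2
  have hq : ContDiffOn ℝ ∞ q T ∧ ∀ i ≤ 2, ‖iteratedFDeriv ℝ i q (inv 1 x)‖ ≤ 128 ^ 5 * ε := by
    rw [hq_def]
    have h := kr_R2_bound hρ hM hε0 hRs hRb
    exact ⟨h.1, fun i hi ↦ h.2 _ hu1 hu2 i hi⟩
  have hB' := hC hT huT hp.1 hq.1 hε0 hε1 hp.2 hq.2
  -- the linear `C²` estimate for the pull-back along `inv 1`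
  have key := norm_iteratedFDeriv_bilinPullback_le hU hT (k := 2)
    (fun z hz ↦ (contDiffAt_sInv 1 (norm_pos_iff.1 (lt_trans (by norm_num) hz.1))).contDiffWithinAt)
    (hB'.1.of_le (WithTop.coe_le_coe.2 le_top)) hmaps hxU hΘ1 (by positivity : 0 ≤ C * ε)
    (fun i h1 hi ↦ hΘ i h1 hi x hx16 hx128) (fun j hj ↦ hB'.2 j hj) hm
  -- KELVIN: near `x` the difference IS the pull-back along `inv 1` of `((p + q)⁴ − p⁴) • δ`
  have hEq : (fun z : E3 ↦ invReadH B ρ₃ X₃ z - schwField (A * M / X₃) z) =ᶠ[𝓝 x]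
      bilinPullback (inv 1) (fun u ↦ (q u * ((p u + q u + p u) *
        ((p u + q u) * (p u + q u) + p u * p u))) • (innerSL ℝ : E3 →L[ℝ] E3 →L[ℝ] ℝ)) := by
    filter_upwards [hU.mem_nhds hxU] with z hz
    have hz0' : 0 < ‖z‖ := lt_trans (by norm_num) hz.1
    have hz0 : z ≠ 0 := norm_pos_iff.1 hz0'
    have hin1 : ρ₃ / 512 < ‖inv ρ₃ z‖ :=
      (lt_norm_sInv_iff hρ.le hz0 _).2 (by nlinarith [hz.2])
    have hin2 : ‖inv ρ₃ z‖ < ρ₃ / 4 :=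
      (norm_sInv_lt_iff hρ.le hz0 _).2 (by nlinarith [hz.1])
    ext v w
    rw [sub_apply, sub_apply, invReadH_apply, bilinPullback_apply, hH _ hin1 hin2]
    simp only [schwField, hp_def, hq_def, smul_apply, innerSL_apply_apply (𝕜 := ℝ), smul_eq_mul]
    rw [inner_fderiv_sInv hρ.le hz0, inner_fderiv_sInv (zero_le_one : (0 : ℝ) ≤ 1) hz0,
      norm_sInv hρ.le z, hn1 z, kr_smul_sInv_one]
    linear_combination
      kr_scalar (A := A) (t := R (inv ρ₃ z)) (s := ⟪v, w⟫) hM.ne' hX.ne' hz0'.ne' hrel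
  rw [(Filter.EventuallyEq.iteratedFDeriv ℝ hEq m).eq_of_nhds]
  refine key.trans (le_of_eq ?_)
  rw [Nat.factorial_two]
  push_cast
  ring

end Summit.FinalStateConjecture.FinalStateConjecture.Theorems.SwallowTheDatum.UniversalWitnessFamily

end
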